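import Mathlib

/-!
# `SnSubsetDichotomy.ThresholdSubsetTriples`, line `SketchIdeator2` — stub `stub_cubeThreshold`

Cube arithmetic for the volume bound of crux `stmt-MatrixMultiplication-10882` (registered stub
`stub_cubeThreshold` of the lead's skeleton for line `SketchIdeator2`).  The line produces ONE set
`X ⊆ S_n` with `|X| = N > √(n!)·e^{-(c/3)√n}` and uses it three times (`X`, `τXτ⁻¹`, `τ²Xτ⁻²`),
so the crux's volume inequality `(n!)^{3/2}·e^{-c√n} < N·N·N` is the cube of the hypothesis:
`(√(n!)·e^{-(c/3)√n})³ = (n!)^{3/2}·e^{-c√n}` (`Real.rpow_div_two_eq_sqrt`, `Real.rpow_ofNat`,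
`Real.exp_nat_mul`), and `t ↦ t³` is strictly monotone on `[0, ∞)` (`pow_lt_pow_left₀`).
-/

namespace Summit.MatrixMultiplication.MatrixMultiplication.Theorems.ThresholdSubsetTriples

/-- **Stub `stub_cubeThreshold` (cube arithmetic).**  `√(n!)·e^{-(c/3)√n} < N` implies
`(n!)^{3/2}·e^{-c√n} < N³`: cube both sides (the left-hand side is nonnegative), using
`(√(n!))³ = (n!)^{3/2}` and `(e^{-(c/3)√n})³ = e^{-c√n}`. [folklore] -/
theorem stub_cubeThreshold : ∀ (c : ℝ) (n N : ℕ), Real.sqrt (n.factorial : ℝ) * Real.exp (-(c / 3 * Real.sqrt (n : ℝ))) < (N : ℝ) → (n.factorial : ℝ) ^ ((3 : ℝ) / 2) * Real.exp (-(c * Real.sqrt (n : ℝ))) < ((N * N * N : ℕ) : ℝ) := by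
  intro c n N hlt
  have hF : (0 : ℝ) ≤ (n.factorial : ℝ) := Nat.cast_nonneg _
  have h0 : 0 ≤ Real.sqrt (n.factorial : ℝ) * Real.exp (-(c / 3 * Real.sqrt (n : ℝ))) := by
    positivity
  have hcube : (Real.sqrt (n.factorial : ℝ) * Real.exp (-(c / 3 * Real.sqrt (n : ℝ)))) ^ 3 <
      (N : ℝ) ^ 3 :=
    pow_lt_pow_left₀ hlt h0 three_ne_zero
  have h3 : ((3 : ℕ) : ℝ) * -(c / 3 * Real.sqrt (n : ℝ)) = -(c * Real.sqrt (n : ℝ)) := by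
    push_cast
    ring
  have hlhs : (Real.sqrt (n.factorial : ℝ) * Real.exp (-(c / 3 * Real.sqrt (n : ℝ)))) ^ 3 =
      (n.factorial : ℝ) ^ ((3 : ℝ) / 2) * Real.exp (-(c * Real.sqrt (n : ℝ))) := by
    rw [mul_pow, Real.rpow_div_two_eq_sqrt _ hF, Real.rpow_ofNat, ← Real.exp_nat_mul, h3]
  have hrhs : (N : ℝ) ^ 3 = ((N * N * N : ℕ) : ℝ) := by
    push_cast
    ring
  rw [← hlhs, ← hrhs]
  exact hcube

end Summit.MatrixMultiplication.MatrixMultiplication.Theorems.ThresholdSubsetTriples
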